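import Literature.Analysis.FluidPDE.TorusNSChessboardTimeAverages
import Literature.Analysis.FluidPDE.ExtremeGrowthVorticityControl
import HarnessLib

/-!
# The a priori bound `∫₀ᵀ ‖u‖_{L^q}^{4q/(3(q−2))} dt ≤ C ν⁻¹ ‖u₀‖₂^{4q/(3(q−2))}` (`2 < q ≤ 6`)
# for classical Navier–Stokes solutions on `T³` (Constantin 1991; Kang–Protas 2021, App. A)

Analysis/FluidPDE proof file (theorems only; no definitions, no named facts).
Search for candidate a priori estimates; no regularity claim.

Kang–Protas 2021 (J. Nonlinear Sci. 32; arXiv:2110.06130), eq. (6) and Appendix A ((A.1)–(A.3)),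
after Constantin 1991: Leray–Hopf weak solutions satisfy
`∫₀ᵀ ‖u(t)‖_{L^q}^{4q/(3(q−2))} dt ≤ C 𝒦₀^{2q/(3(q−2))}`, `2 ≤ q ≤ 6` (restated as (3.9) of
Ramírez–Protas 2026, arXiv:2604.13338). Printed derivation (App. A): Gagliardo–Nirenberg
`‖u‖_{L^q} ≤ C ‖∇u‖₂^α ‖u‖₂^{1−α}`, `α = 3(q−2)/(2q)`; raise to the power `2/α`, integrate in time,
and use the energy equation: `∫₀ᵀ ‖u‖_q^{4q/(3(q−2))} ≤ C ‖u₀‖₂^{2(1−α)/α} ∫₀ᵀ ‖∇u‖₂² =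
(C/2ν) ‖u₀‖₂^{2(1−α)/α} (‖u₀‖₂² − ‖u(T)‖₂²)`. This is the square `(0, m)`, `1 < m ≤ 3`
(`q = 2m`), of Gibbon's chessboard of bounded time averages — the range that Gibbon 2019 leaves
out and that the tree's `TorusNSChessboardTimeAverages` (`3 < m < ∞`) does not cover; with it the
cell's EXTREME-GROWTH row G8 (time-integrated `L^q` bounds) is typed for all `q > 2`.

On the unit torus `T^d`, `card d = 3`, for classical solutions of the unforced equations with
mean-zero velocity slices on `[0, T]` (`2⁻¹‖u‖₂²` non-increasing, `∫₀ᵀ‖∇u‖₂² ≤ ‖u(0)‖₂²/(2ν)`):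

* `Torus.exists_classicalNS_integral_norm_rpow_le_of_lt_six` — `2 < q < 6`:
  `∫₀ᵀ (∫‖u(t)‖^q)^{4/(3(q−2))} dt ≤ K ν⁻¹ (∫‖u(0)‖²)^{2q/(3(q−2))}`, `K = K(q, d)`;
* `Torus.exists_classicalNS_integral_norm_six_cbrt_le` — the endpoint `q = 6`:
  `∫₀ᵀ (∫‖u(t)‖⁶)^{1/3} dt ≤ K ν⁻¹ ∫‖u(0)‖²`.

Inputs (tree): the `L²`–`L⁶` interpolation `Torus.integral_rpow_le_interpolate_two_six'`, the
mean-zero Sobolev bound `Torus.exists_integral_norm_pow_six_le_gradNormSq_cube`, energy decay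
`kineticEnergy_le_of_le`, the dissipation bound `Torus.classicalNS_integral_gradNormSq_le`.
Deviations from print: classical solutions (print: Leray–Hopf weak), unit torus with mean-zero
slices, the `ν`-dependence written out (`𝒦₀ = ½‖u₀‖₂²`; the printed `C` absorbs `ν`), constants
existential through the Sobolev constant.

## Mathlib / tree search

Tree (used): as listed; `Torus.IsClassicalNSSolutionOn.hasDerivWithinAt_half_gradNormSq`
(continuity of `t ↦ ‖∇u‖₂²`), `Torus.continuousOn_integral_of_continuousOn_stLift`. Searched
(`lean search`): `4 \* q / \(3|2q/\(3\(q|Constantin1991|LPSbound` — only the `3 < m` row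
(`Torus.exists_classicalNS_integral_norm_rpow_le`).

## References

* D. Kang, B. Protas, *Searching for singularities in Navier–Stokes flows based on the
  Ladyzhenskaya–Prodi–Serrin conditions*, J. Nonlinear Sci. 32 (2022) 81; arXiv:2110.06130, eq. (6)
  and Appendix A (held: paper:arxiv-2110.06130, pp. 4, 19). [KangProtas2022]
* P. Constantin, *Remarks on the Navier–Stokes equations*, in: New Perspectives in Turbulence
  (L. Sirovich, ed.), Springer 1991, 229–261. [cited through Kang–Protas]
* E. Ramírez, B. Protas, arXiv:2604.13338 (2026), eqs. (3.9)–(3.10). [RamirezProtas2026]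
* J. D. Gibbon, *J. Nonlinear Sci.* 29 (2019) 215–228, Theorem 2. [Gibbon2019Chessboard]
-/

noncomputable section

open MeasureTheory Finset Set Filter Topology
open scoped InnerProductSpace RealInnerProductSpace ContDiff

namespace Literature.Analysis.FluidPDE

open Literature.Analysis.FunctionSpaces

variable {d : Type*} [Fintype d] [DecidableEq d]

namespace LebesgueTimeAverages

/-- Along a classical solution, `t ↦ ∫ ‖u(t)‖^r` (`r ≥ 0`) is continuous on the time set
(joint smoothness, tube lemma). [folklore] -/
private theorem continuousOn_integral_norm_rpow {ν : ℝ} {S : Set ℝ}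
    {f u : ℝ → UnitAddTorus d → EuclideanSpace ℝ d} {p : ℝ → UnitAddTorus d → ℝ}
    (h : Torus.IsClassicalNSSolutionOn S ν f u p) {r : ℝ} (hr : 0 ≤ r) :
    ContinuousOn (fun t => ∫ x, ‖u t x‖ ^ r) S := by
  have hst : ContinuousOn (Torus.stLift u) (S ×ˢ univ) := h.smooth_velocity.continuousOn_stLift
  refine Torus.continuousOn_integral_of_continuousOn_stLift ?_
  have e : Torus.stLift (fun t x => ‖u t x‖ ^ r) = fun z => ‖Torus.stLift u z‖ ^ r := rfl
  rw [e]
  exact hst.norm.rpow_const fun z _ => Or.inr hr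

/-- Along a classical solution on `[a, b]`, `t ↦ ‖∇u(t)‖₂²` is continuous. [folklore] -/
private theorem continuousOn_gradNormSq {ν a b : ℝ} (hab : a < b)
    {f u : ℝ → UnitAddTorus d → EuclideanSpace ℝ d} {p : ℝ → UnitAddTorus d → ℝ}
    (h : Torus.IsClassicalNSSolutionOn (Icc a b) ν f u p) :
    ContinuousOn (fun t => Torus.gradNormSq (u t)) (Icc a b) := by
  intro t ht
  have h1 : ContinuousWithinAt (fun s => (2 : ℝ) * (2⁻¹ * Torus.gradNormSq (u s))) (Icc a b) t :=
    continuousWithinAt_const.mul (h.hasDerivWithinAt_half_gradNormSq hab ht).continuousWithinAt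
  refine h1.congr (fun s _ => ?_) ?_ <;> ring

/-- Energy decay in the form `∫‖u(t)‖² ≤ ∫‖u(0)‖²` on `[0, T]`. [folklore] -/
private theorem integral_norm_sq_le_initial {ν T : ℝ} (hν : 0 < ν)
    {u : ℝ → UnitAddTorus d → EuclideanSpace ℝ d} {p : ℝ → UnitAddTorus d → ℝ}
    (h : Torus.IsClassicalNSSolutionOn (Icc 0 T) ν 0 u p) {t : ℝ} (ht : t ∈ Icc 0 T) :
    ∫ x, ‖u t x‖ ^ 2 ≤ ∫ x, ‖u 0 x‖ ^ 2 := by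
  have hK := kineticEnergy_le_of_le hν.le h (convex_Icc 0 T) ht.1
    (fun s hs => ⟨hs.1, hs.2.trans ht.2⟩)
  unfold Torus.kineticEnergy at hK
  linarith

end LebesgueTimeAverages

open LebesgueTimeAverages

/-- **The time-integrated `L^q` bound, `2 < q < 6`** (Kang–Protas 2021, eq. (6) and App. A
(A.1)–(A.3), after Constantin 1991: "`∫₀ᵀ ‖u(τ)‖_{L^q}^{4q/(3(q−2))} dτ ≤ C 𝒦₀^{2q/(3(q−2))}`,
`2 ≤ q ≤ 6`"; Gibbon's chessboard square `(0, m)`, `1 < m < 3`). On `T^d`, `card d = 3`: for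
`2 < q < 6` there is `K = K(q, d) ≥ 0` such that every classical solution of the unforced
Navier–Stokes equations with `ν > 0` on `[0, T] × T^d`, `T > 0`, with mean-zero velocity slices
satisfies
`∫₀ᵀ (∫ ‖u(t)‖^q)^{4/(3(q−2))} dt ≤ K ν⁻¹ (∫ ‖u(0)‖²)^{2q/(3(q−2))}`
(i.e. `∫₀ᵀ ‖u‖_q^{4q/(3(q−2))} ≤ K ν⁻¹ ‖u₀‖₂^{4q/(3(q−2))}`). Printed proof: interpolation
`∫|u|^q ≤ (∫|u|²)^{(6−q)/4}(∫|u|⁶)^{(q−2)/4}`, Sobolev `∫|u|⁶ ≤ C₆‖∇u‖₂⁶`, hence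
`(∫|u|^q)^{4/(3(q−2))} ≤ C₆^{1/3} (∫|u|²)^{(6−q)/(3(q−2))} ‖∇u‖₂²`; energy decay and
`∫₀ᵀ‖∇u‖₂² ≤ ‖u(0)‖₂²/(2ν)`. [cite: KangProtas2022, eq. (6) and Appendix A (A.3)] -/
theorem Torus.exists_classicalNS_integral_norm_rpow_le_of_lt_six (hd : Fintype.card d = 3)
    {q : ℝ} (hq2 : 2 < q) (hq6 : q < 6) :
    ∃ K : ℝ, 0 ≤ K ∧ ∀ {ν T : ℝ}, 0 < ν → 0 < T →
      ∀ {u : ℝ → UnitAddTorus d → EuclideanSpace ℝ d} {p : ℝ → UnitAddTorus d → ℝ},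
        Torus.IsClassicalNSSolutionOn (Icc 0 T) ν 0 u p →
        (∀ t ∈ Icc 0 T, Torus.HasZeroMean (u t)) →
        ∫ t in (0 : ℝ)..T, (∫ x, ‖u t x‖ ^ q) ^ (4 / (3 * (q - 2))) ≤
          K * ν⁻¹ * (∫ x, ‖u 0 x‖ ^ 2) ^ (2 * q / (3 * (q - 2))) := by
  obtain ⟨C₆, hC₆0, hC₆⟩ := Torus.exists_integral_norm_pow_six_le_gradNormSq_cube (d := d) hd
  have hq2' : 0 < q - 2 := by linarith
  have hq6' : 0 < 6 - q := by linarith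
  -- exponents
  set e : ℝ := 4 / (3 * (q - 2)) with he
  set a : ℝ := (6 - q) / (3 * (q - 2)) with ha
  have he0 : 0 < e := by rw [he]; positivity
  have ha0 : 0 ≤ a := by rw [ha]; positivity
  have hea : (6 - q) / 4 * e = a := by rw [he, ha]; field_simp
  have heC : (q - 2) / 4 * e = 1 / 3 := by rw [he]; field_simp
  have ha1 : a + 1 = 2 * q / (3 * (q - 2)) := by rw [ha]; field_simp; ring
  set K : ℝ := C₆ ^ (1 / 3 : ℝ) / 2 with hK
  have hK0 : 0 ≤ K := by rw [hK]; exact div_nonneg (Real.rpow_nonneg hC₆0 _) (by norm_num)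
  refine ⟨K, hK0, fun {ν T} hν hT {u p} h hmean => ?_⟩
  set N : ℝ → ℝ := fun s => ∫ x, ‖u s x‖ ^ 2 with hN
  set G : ℝ → ℝ := fun s => Torus.gradNormSq (u s) with hG
  set F : ℝ → ℝ := fun s => ∫ x, ‖u s x‖ ^ q with hF
  have hN0 : ∀ s, 0 ≤ N s := fun s => integral_nonneg fun x => sq_nonneg _
  have hG0 : ∀ s, 0 ≤ G s := fun s => Torus.gradNormSq_nonneg _
  have hF0 : ∀ s, 0 ≤ F s := fun s => integral_nonneg fun x => Real.rpow_nonneg (norm_nonneg _) _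
  -- ### the pointwise bound `(F t)^e ≤ C₆^{1/3} (N 0)^a G t` on `[0, T]`
  have hpt : ∀ t ∈ Icc 0 T, F t ^ e ≤ C₆ ^ (1 / 3 : ℝ) * N 0 ^ a * G t := by
    intro t ht
    have hut : Torus.IsSmooth (u t) := h.smooth_velocity.isSmooth_slice ht
    have hcont : Continuous fun x => ‖u t x‖ := hut.continuous.norm
    -- interpolation and Sobolev
    have h1 := Torus.integral_rpow_le_interpolate_two_six' hq2 hq6 hcont (fun x => norm_nonneg _)
    have h2 : ∫ x, ‖u t x‖ ^ 6 ≤ C₆ * G t ^ 3 := hC₆ (u t) hut (hmean t ht)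
    have h60 : 0 ≤ ∫ x, ‖u t x‖ ^ 6 := integral_nonneg fun x => pow_nonneg (norm_nonneg _) 6
    have h3 : F t ≤ N t ^ ((6 - q) / 4) * (C₆ * G t ^ 3) ^ ((q - 2) / 4) :=
      h1.trans (mul_le_mul_of_nonneg_left (Real.rpow_le_rpow h60 h2 (by positivity))
        (Real.rpow_nonneg (hN0 t) _))
    -- raise to the power `e`
    have h4 : F t ^ e ≤ (N t ^ ((6 - q) / 4) * (C₆ * G t ^ 3) ^ ((q - 2) / 4)) ^ e :=
      Real.rpow_le_rpow (hF0 t) h3 he0.le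
    have hCG0 : 0 ≤ C₆ * G t ^ 3 := mul_nonneg hC₆0 (pow_nonneg (hG0 t) 3)
    have e5 : (N t ^ ((6 - q) / 4) * (C₆ * G t ^ 3) ^ ((q - 2) / 4)) ^ e =
        C₆ ^ (1 / 3 : ℝ) * N t ^ a * G t := by
      rw [Real.mul_rpow (Real.rpow_nonneg (hN0 t) _) (Real.rpow_nonneg hCG0 _),
        ← Real.rpow_mul (hN0 t), ← Real.rpow_mul hCG0, hea, heC,
        Real.mul_rpow hC₆0 (pow_nonneg (hG0 t) 3)]
      have : (G t ^ 3) ^ (1 / 3 : ℝ) = G t := by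
        rw [← Real.rpow_natCast, ← Real.rpow_mul (hG0 t)]; norm_num
      rw [this]; ring
    rw [e5] at h4
    -- energy decay: `N t ≤ N 0`
    have hNt : N t ^ a ≤ N 0 ^ a :=
      Real.rpow_le_rpow (hN0 t) (integral_norm_sq_le_initial hν h ht) ha0
    calc F t ^ e ≤ C₆ ^ (1 / 3 : ℝ) * N t ^ a * G t := h4
      _ ≤ C₆ ^ (1 / 3 : ℝ) * N 0 ^ a * G t := by
          have := mul_le_mul_of_nonneg_left hNt (Real.rpow_nonneg hC₆0 (1 / 3 : ℝ))
          exact mul_le_mul_of_nonneg_right this (hG0 t)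
  -- ### integrate over `[0, T]`
  have hFc : ContinuousOn (fun t => F t ^ e) (Icc 0 T) :=
    (continuousOn_integral_norm_rpow h (by linarith : (0 : ℝ) ≤ q)).rpow_const
      fun s _ => Or.inr he0.le
  have hGc : ContinuousOn G (Icc 0 T) := continuousOn_gradNormSq hT h
  have hmono : ∫ t in (0 : ℝ)..T, F t ^ e ≤
      ∫ t in (0 : ℝ)..T, C₆ ^ (1 / 3 : ℝ) * N 0 ^ a * G t := by
    refine intervalIntegral.integral_mono_on hT.le (hFc.intervalIntegrable_of_Icc hT.le)
      ((continuousOn_const.mul hGc).intervalIntegrable_of_Icc hT.le) hpt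
  have hGint : ∫ t in (0 : ℝ)..T, G t ≤ N 0 / (2 * ν) :=
    Torus.classicalNS_integral_gradNormSq_le hν hT h
  have hc0 : 0 ≤ C₆ ^ (1 / 3 : ℝ) * N 0 ^ a :=
    mul_nonneg (Real.rpow_nonneg hC₆0 _) (Real.rpow_nonneg (hN0 0) _)
  calc ∫ t in (0 : ℝ)..T, F t ^ e
      ≤ ∫ t in (0 : ℝ)..T, C₆ ^ (1 / 3 : ℝ) * N 0 ^ a * G t := hmono
    _ = C₆ ^ (1 / 3 : ℝ) * N 0 ^ a * ∫ t in (0 : ℝ)..T, G t := by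
        rw [intervalIntegral.integral_const_mul]
    _ ≤ C₆ ^ (1 / 3 : ℝ) * N 0 ^ a * (N 0 / (2 * ν)) := mul_le_mul_of_nonneg_left hGint hc0
    _ = K * ν⁻¹ * (N 0 ^ a * N 0) := by rw [hK]; field_simp
    _ = K * ν⁻¹ * N 0 ^ (2 * q / (3 * (q - 2))) := by
        rw [← ha1, Real.rpow_add' (hN0 0) (by rw [ha1]; positivity), Real.rpow_one]

/-- **The time-integrated `L⁶` bound (endpoint `q = 6`)** (Kang–Protas 2021, (6)/(A.3) with
`q = 6`: `∫₀ᵀ‖u‖_{L⁶}² ≤ C𝒦₀`; Gibbon's square `(0, 3)`: plain Sobolev and the energy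
dissipation bound). On `T^d`, `card d = 3`, there is `K ≥ 0` with
`∫₀ᵀ (∫ ‖u(t)‖⁶)^{1/3} dt ≤ K ν⁻¹ ∫ ‖u(0)‖²` along every classical mean-zero solution of the
unforced equations on `[0, T] × T^d`. [cite: KangProtas2022, eq. (6) and Appendix A (A.3)] -/
theorem Torus.exists_classicalNS_integral_norm_six_cbrt_le (hd : Fintype.card d = 3) :
    ∃ K : ℝ, 0 ≤ K ∧ ∀ {ν T : ℝ}, 0 < ν → 0 < T →
      ∀ {u : ℝ → UnitAddTorus d → EuclideanSpace ℝ d} {p : ℝ → UnitAddTorus d → ℝ},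
        Torus.IsClassicalNSSolutionOn (Icc 0 T) ν 0 u p →
        (∀ t ∈ Icc 0 T, Torus.HasZeroMean (u t)) →
        ∫ t in (0 : ℝ)..T, (∫ x, ‖u t x‖ ^ (6 : ℝ)) ^ (1 / 3 : ℝ) ≤
          K * ν⁻¹ * ∫ x, ‖u 0 x‖ ^ 2 := by
  obtain ⟨C₆, hC₆0, hC₆⟩ := Torus.exists_integral_norm_pow_six_le_gradNormSq_cube (d := d) hd
  set K : ℝ := C₆ ^ (1 / 3 : ℝ) / 2 with hK
  have hK0 : 0 ≤ K := by rw [hK]; exact div_nonneg (Real.rpow_nonneg hC₆0 _) (by norm_num)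
  refine ⟨K, hK0, fun {ν T} hν hT {u p} h hmean => ?_⟩
  set G : ℝ → ℝ := fun s => Torus.gradNormSq (u s) with hG
  set F : ℝ → ℝ := fun s => ∫ x, ‖u s x‖ ^ (6 : ℝ) with hF
  have hG0 : ∀ s, 0 ≤ G s := fun s => Torus.gradNormSq_nonneg _
  have hF0 : ∀ s, 0 ≤ F s := fun s => integral_nonneg fun x => Real.rpow_nonneg (norm_nonneg _) _
  have hN0 : 0 ≤ ∫ x, ‖u 0 x‖ ^ 2 := integral_nonneg fun x => sq_nonneg _
  have hpt : ∀ t ∈ Icc 0 T, F t ^ (1 / 3 : ℝ) ≤ C₆ ^ (1 / 3 : ℝ) * G t := by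
    intro t ht
    have hut : Torus.IsSmooth (u t) := h.smooth_velocity.isSmooth_slice ht
    have h2 : ∫ x, ‖u t x‖ ^ 6 ≤ C₆ * G t ^ 3 := hC₆ (u t) hut (hmean t ht)
    have eF : F t = ∫ x, ‖u t x‖ ^ 6 := by
      rw [hF]
      exact integral_congr_ae (ae_of_all _ fun x => by
        show ‖u t x‖ ^ (6 : ℝ) = ‖u t x‖ ^ (6 : ℕ)
        rw [show (6 : ℝ) = ((6 : ℕ) : ℝ) by norm_num, Real.rpow_natCast])
    rw [eF]
    have h60 : 0 ≤ ∫ x, ‖u t x‖ ^ 6 := integral_nonneg fun x => pow_nonneg (norm_nonneg _) 6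
    have h3 := Real.rpow_le_rpow h60 h2 (by norm_num : (0 : ℝ) ≤ 1 / 3)
    refine h3.trans (le_of_eq ?_)
    rw [Real.mul_rpow hC₆0 (pow_nonneg (hG0 t) 3), ← Real.rpow_natCast, ← Real.rpow_mul (hG0 t)]
    norm_num
  have hFc : ContinuousOn (fun t => F t ^ (1 / 3 : ℝ)) (Icc 0 T) :=
    (continuousOn_integral_norm_rpow h (by norm_num : (0 : ℝ) ≤ 6)).rpow_const
      fun s _ => Or.inr (by norm_num)
  have hGc : ContinuousOn G (Icc 0 T) := continuousOn_gradNormSq hT h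
  have hmono : ∫ t in (0 : ℝ)..T, F t ^ (1 / 3 : ℝ) ≤ ∫ t in (0 : ℝ)..T, C₆ ^ (1 / 3 : ℝ) * G t :=
    intervalIntegral.integral_mono_on hT.le (hFc.intervalIntegrable_of_Icc hT.le)
      ((continuousOn_const.mul hGc).intervalIntegrable_of_Icc hT.le) hpt
  have hGint : ∫ t in (0 : ℝ)..T, G t ≤ (∫ x, ‖u 0 x‖ ^ 2) / (2 * ν) :=
    Torus.classicalNS_integral_gradNormSq_le hν hT h
  calc ∫ t in (0 : ℝ)..T, F t ^ (1 / 3 : ℝ)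
      ≤ ∫ t in (0 : ℝ)..T, C₆ ^ (1 / 3 : ℝ) * G t := hmono
    _ = C₆ ^ (1 / 3 : ℝ) * ∫ t in (0 : ℝ)..T, G t := by rw [intervalIntegral.integral_const_mul]
    _ ≤ C₆ ^ (1 / 3 : ℝ) * ((∫ x, ‖u 0 x‖ ^ 2) / (2 * ν)) :=
        mul_le_mul_of_nonneg_left hGint (Real.rpow_nonneg hC₆0 _)
    _ = K * ν⁻¹ * ∫ x, ‖u 0 x‖ ^ 2 := by rw [hK]; field_simp

end Literature.Analysis.FluidPDE
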